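import Mathlib.Data.Nat.Choose.Basic
import Mathlib.Data.Nat.Choose.Sum
import Mathlib.Algebra.BigOperators.Intervals
import Mathlib.Algebra.Order.BigOperators.Group.Finset
import Mathlib.Tactic
import Summits.CriticalPhenomena.PercolationContinuityZ3.Theorems.PercNearOneGluingNoHeavyLowerTailUAll
import Summits.CriticalPhenomena.PercolationContinuityZ3.Theorems.PercNearOneGluingNoHeavyLowerTailCoreMaster
import Summits.CriticalPhenomena.PercolationContinuityZ3.Theorems.PercNearOneGluingNoHeavyLowerTailCoreLemma
import HarnessLib

/-!
# The biased-buffer two-block inequality (block form of CORE(t)) for every bias `ρ ≥ 1`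

Support file for the Sahi / Conjecture-P programme of route `PercNearOneGluingNoHeavy`
(`--supports stmt-CriticalPhenomena-4575`, prover prim-l12-p5 gen 28; proof notes
`prim-l12-p5/OMEGA1-g27.md` §2(d), §5.1 and `prim-l12-p5/U-PROOF-g28.md`).  No definitions, no named facts,
no sorries.

OMEGA1-g27 §2 writes CORE(t) (the `t`-biased CORE LEMMA, whose Beta-mixture over `t` is (Ω₁) at rate `θ`, §1
there) through the MASTER IDENTITY as a central two-block sum whose fair buffer `C(L,z)` is replaced by the
BIASED buffer `C(L,z)ρ^z`, `ρ = t/(1-t)`; §5.1 expands the biased buffer into fair buffers of smaller size,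
`C(L,z)ρ^z = ∑_m C(L,m)(ρ-1)^m C(L-m,z-m)`, each piece being an off-centre section `j = m` — a TEST(m) sum.
With THEOREM U (`UAll.u_all`) every piece is nonnegative, so for `ρ ≥ 1`:

* `biased_buffer` : the expansion `C(L,z)ρ^z = ∑_{m ≤ L} C(L,m)(ρ-1)^m C(L-m,z-m)[m ≤ z]`;
* `core_rho` (**block form of CORE(t), `ρ ≥ 1`**) : for `2K = M₁+M₂+L = N` and symmetric unimodal `w₁, w₂ ≥ 0`,
  `0 ≤ ∑ C(M₁,x₁)w₁ C(M₂,x₂)w₂ · C(L,z)ρ^z · (M₁M₂ + (N-1) d₁d₂)`, `z = K-x₁-x₂`, `d_b = 2x_b-M_b`.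
* `core_rho_pos` (**all `ρ > 0`**, i.e. CORE(t) in block form for every `t ∈ (0,1)`) : the case `ρ < 1` is the
  reflection `x_b ↦ M_b - x_b`, `z ↦ L - z` (`CoreMaster.sum_reflect₂`) of the case `1/ρ ≥ 1`.
-/

namespace Summit.CriticalPhenomena.PercolationContinuityZ3.Theorems

namespace CoreRho

open Finset

/-- The biased buffer as a positive combination of smaller fair buffers (`ρ ≥ 1` makes the coefficients
nonnegative): `C(L,z)ρ^z = ∑_{m ≤ L} C(L,m)(ρ-1)^m·C(L-m,z-m)[m ≤ z]`. -/
theorem biased_buffer (L z : ℕ) (ρ : ℝ) :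
    (L.choose z : ℝ) * ρ ^ z =
      ∑ m ∈ range (L + 1), (L.choose m : ℝ) * (ρ - 1) ^ m *
        (if m ≤ z then ((L - m).choose (z - m) : ℝ) else 0) := by
  -- ρ^z = ((ρ-1)+1)^z = ∑_{m ≤ z} C(z,m)(ρ-1)^m, and C(L,z)C(z,m) = C(L,m)C(L-m,z-m)
  have hpow : ρ ^ z = ∑ m ∈ range (z + 1), (ρ - 1) ^ m * (z.choose m : ℝ) := by
    have := add_pow (ρ - 1) 1 z
    simp only [one_pow, mul_one, sub_add_cancel] at this
    rw [this]
  rw [hpow, mul_sum]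
  rw [CoreLemma.sum_range_eq_of_support (fun m => (L.choose z : ℝ) * ((ρ - 1) ^ m * (z.choose m : ℝ))) z L
    (fun m hm => by simp [Nat.choose_eq_zero_of_lt hm])
    (fun m hm => by
      rcases Nat.lt_or_ge z m with h | h
      · simp [Nat.choose_eq_zero_of_lt h]
      · simp [Nat.choose_eq_zero_of_lt (show L < z by omega)])]
  refine sum_congr rfl fun m _ => ?_
  by_cases hmz : m ≤ z
  · rw [if_pos hmz]
    have h := Nat.choose_mul (n := L) (k := z) (s := m) hmz
    have hc : ((L.choose z * z.choose m : ℕ) : ℝ) = ((L.choose m * (L - m).choose (z - m) : ℕ) : ℝ) := by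
      rw [h]
    push_cast at hc
    linear_combination ((ρ - 1) ^ m) * hc
  · rw [if_neg hmz, Nat.choose_eq_zero_of_lt (show z < m by omega)]
    simp

/-- **Block form of CORE(t) for `ρ ≥ 1`.**  For `2K = M₁+M₂+L =: N`, symmetric unimodal `w₁, w₂ ≥ 0` and
`ρ ≥ 1`: `0 ≤ ∑ C(M₁,x₁)w₁(x₁) C(M₂,x₂)w₂(x₂) C(L,K-x₁-x₂) ρ^{K-x₁-x₂} (M₁M₂ + (N-1)(2x₁-M₁)(2x₂-M₂))`.
(The `m`-th piece of `biased_buffer` is the off-centre section `j = m` with buffer `L-m`; it is nonnegative by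
`UAll.u_all` with `κ = M₁M₂/(N-1)`, admissible since `(N-m)(N-m-1) - (N-1)(N-m-m²) = N m(m-1) ≥ 0`.) -/
theorem core_rho (M₁ M₂ L K : ℕ) (hN : 2 * K = M₁ + M₂ + L) (ρ : ℝ) (hρ : 1 ≤ ρ)
    (w₁ w₂ : ℕ → ℝ) (hw₁nn : ∀ x, 0 ≤ w₁ x)
    (hw₁sym : ∀ x, x ≤ M₁ → w₁ x = w₁ (M₁ - x)) (hw₁uni : ∀ x, 2 * x + 2 ≤ M₁ → w₁ x ≤ w₁ (x + 1))
    (hw₂nn : ∀ x, 0 ≤ w₂ x)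
    (hw₂sym : ∀ x, x ≤ M₂ → w₂ x = w₂ (M₂ - x)) (hw₂uni : ∀ x, 2 * x + 2 ≤ M₂ → w₂ x ≤ w₂ (x + 1)) :
    0 ≤ ∑ x₁ ∈ range (M₁ + 1), ∑ x₂ ∈ range (M₂ + 1),
        (M₁.choose x₁ : ℝ) * w₁ x₁ * ((M₂.choose x₂ : ℝ) * w₂ x₂) *
          (if x₁ + x₂ ≤ K then (L.choose (K - (x₁ + x₂)) : ℝ) * ρ ^ (K - (x₁ + x₂)) else 0) *
          ((M₁ : ℝ) * M₂ + ((((M₁ + M₂ + L : ℕ)) : ℝ) - 1) * ((2 * (x₁ : ℝ) - M₁) * (2 * (x₂ : ℝ) - M₂))) := by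
  -- expand the biased buffer and move the sum over m outside
  have hexp : ∀ x₁ ∈ range (M₁ + 1), ∀ x₂ ∈ range (M₂ + 1),
      (M₁.choose x₁ : ℝ) * w₁ x₁ * ((M₂.choose x₂ : ℝ) * w₂ x₂) *
          (if x₁ + x₂ ≤ K then (L.choose (K - (x₁ + x₂)) : ℝ) * ρ ^ (K - (x₁ + x₂)) else 0) *
          ((M₁ : ℝ) * M₂ + ((((M₁ + M₂ + L : ℕ)) : ℝ) - 1) * ((2 * (x₁ : ℝ) - M₁) * (2 * (x₂ : ℝ) - M₂))) =
      ∑ m ∈ range (L + 1), (L.choose m : ℝ) * (ρ - 1) ^ m *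
        ((M₁.choose x₁ : ℝ) * w₁ x₁ * ((M₂.choose x₂ : ℝ) * w₂ x₂) *
          (if x₁ + x₂ + m ≤ K then ((L - m).choose (K - m - (x₁ + x₂)) : ℝ) else 0) *
          ((M₁ : ℝ) * M₂ + ((((M₁ + M₂ + L : ℕ)) : ℝ) - 1) * ((2 * (x₁ : ℝ) - M₁) * (2 * (x₂ : ℝ) - M₂)))) := by
    intro x₁ _ x₂ _
    by_cases hK : x₁ + x₂ ≤ K
    · rw [if_pos hK, biased_buffer, mul_sum, sum_mul]
      refine sum_congr rfl fun m hm => ?_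
      by_cases hm : m ≤ K - (x₁ + x₂)
      · rw [if_pos hm, if_pos (show x₁ + x₂ + m ≤ K by omega)]
        have e : K - (x₁ + x₂) - m = K - m - (x₁ + x₂) := by omega
        rw [e]
        ring
      · rw [if_neg hm, if_neg (show ¬ (x₁ + x₂ + m ≤ K) by omega)]
        ring
    · rw [if_neg hK]
      have hz : ∀ m ∈ range (L + 1), (L.choose m : ℝ) * (ρ - 1) ^ m *
          ((M₁.choose x₁ : ℝ) * w₁ x₁ * ((M₂.choose x₂ : ℝ) * w₂ x₂) *
            (if x₁ + x₂ + m ≤ K then ((L - m).choose (K - m - (x₁ + x₂)) : ℝ) else 0) *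
            ((M₁ : ℝ) * M₂ + ((((M₁ + M₂ + L : ℕ)) : ℝ) - 1) * ((2 * (x₁ : ℝ) - M₁) * (2 * (x₂ : ℝ) - M₂)))) = 0 := by
        intro m _
        rw [if_neg (show ¬ (x₁ + x₂ + m ≤ K) by omega)]
        ring
      rw [sum_congr rfl hz, sum_const_zero]
      ring
  rw [sum_congr rfl fun x₁ hx₁ => sum_congr rfl fun x₂ hx₂ => hexp x₁ hx₁ x₂ hx₂]
  simp_rw [sum_comm (s := range (M₂ + 1)) (t := range (L + 1))]
  rw [sum_comm]
  -- each piece m is (N-1) times a THEOREM-U sum at the section j = m with buffer L - m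
  refine sum_nonneg fun m hm => ?_
  have hmL : m ≤ L := by have := mem_range.mp hm; omega
  simp_rw [← mul_sum]
  refine mul_nonneg (mul_nonneg (by positivity) (pow_nonneg (by linarith) m)) ?_
  rcases Nat.lt_or_ge K m with hKm | hKm
  · -- no admissible (x₁, x₂): the piece vanishes
    refine le_of_eq (Eq.symm (sum_eq_zero fun x₁ _ => sum_eq_zero fun x₂ _ => ?_))
    rw [if_neg (show ¬ (x₁ + x₂ + m ≤ K) by omega)]
    ring
  -- for m ≤ K the guard is x₁ + x₂ ≤ K - m
  have eg : ∀ x₁ x₂ : ℕ, (if x₁ + x₂ + m ≤ K then ((L - m).choose (K - m - (x₁ + x₂)) : ℝ) else 0) =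
      (if x₁ + x₂ ≤ K - m then ((L - m).choose (K - m - (x₁ + x₂)) : ℝ) else 0) := by
    intro x₁ x₂
    by_cases h : x₁ + x₂ + m ≤ K
    · rw [if_pos h, if_pos (show x₁ + x₂ ≤ K - m by omega)]
    · rw [if_neg h, if_neg (show ¬ (x₁ + x₂ ≤ K - m) by omega)]
  simp_rw [eg]
  · -- N' = M₁+M₂+(L-m), K' = K-m, j' = m
    have hN' : 2 * (K - m) + m = M₁ + M₂ + (L - m) := by omega
    rcases Nat.lt_or_ge 1 (M₁ + M₂ + L) with hN2 | hN2
    · have hNpos : (0 : ℝ) < (((M₁ + M₂ + L : ℕ)) : ℝ) - 1 := by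
        have : (1 : ℝ) < (((M₁ + M₂ + L : ℕ)) : ℝ) := by exact_mod_cast hN2
        linarith
      set κ : ℝ := (M₁ : ℝ) * M₂ / ((((M₁ + M₂ + L : ℕ)) : ℝ) - 1) with hκ
      have hκnn : 0 ≤ κ := by rw [hκ]; positivity
      have hκ₀ : (M₁ : ℝ) * M₂ * (((M₁ + M₂ + (L - m) : ℕ) : ℝ) -
          (((M₁ + M₂ + (L - m) : ℕ) : ℝ) - 2 * (((K - m : ℕ)) : ℝ)) ^ 2) ≤
          κ * (((M₁ + M₂ + (L - m) : ℕ) : ℝ) * (((M₁ + M₂ + (L - m) : ℕ) : ℝ) - 1)) := by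
        rw [hκ, div_mul_eq_mul_div, le_div_iff₀ hNpos]
        have e1 : (((M₁ + M₂ + (L - m) : ℕ)) : ℝ) = (((M₁ + M₂ + L : ℕ)) : ℝ) - m := by
          push_cast [Nat.cast_sub hmL]; ring
        have e2 : (((M₁ + M₂ + (L - m) : ℕ) : ℝ) - 2 * (((K - m : ℕ)) : ℝ)) = (m : ℝ) := by
          have : ((2 * K : ℕ) : ℝ) = (((M₁ + M₂ + L : ℕ)) : ℝ) := by rw [hN]
          push_cast [Nat.cast_sub hmL, Nat.cast_sub hKm] at this ⊢
          linarith
        rw [e2, e1]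
        set Nr : ℝ := (((M₁ + M₂ + L : ℕ)) : ℝ)
        -- M₁M₂ (N-m-m²)(N-1) ≤ M₁M₂ (N-m)(N-m-1)  ⟸  N m (m-1) ≥ 0
        have hMM : 0 ≤ (M₁ : ℝ) * M₂ := by positivity
        have hm0 : (0 : ℝ) ≤ m := by positivity
        have key : 0 ≤ (Nr - m) * (Nr - m - 1) - (Nr - m - (m : ℝ) ^ 2) * (Nr - 1) := by
          have e : (Nr - m) * (Nr - m - 1) - (Nr - m - (m : ℝ) ^ 2) * (Nr - 1) = Nr * ((m : ℝ) * ((m : ℝ) - 1)) := by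
            ring
          rw [e]
          refine mul_nonneg (by linarith) ?_
          rcases Nat.eq_zero_or_pos m with h0 | h0
          · subst h0; simp
          · have : (1 : ℝ) ≤ m := by exact_mod_cast h0
            exact mul_nonneg hm0 (by linarith)
        nlinarith [mul_nonneg hMM key]
      have hU := UAll.u_all M₁ M₂ (L - m) (K - m) m hN' κ hκnn hκ₀ w₁ w₂ hw₁nn hw₁sym hw₁uni hw₂nn hw₂sym hw₂uni
      have e : ∑ x₁ ∈ range (M₁ + 1), ∑ x₂ ∈ range (M₂ + 1),
          (M₁.choose x₁ : ℝ) * w₁ x₁ * ((M₂.choose x₂ : ℝ) * w₂ x₂) *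
            (if x₁ + x₂ ≤ K - m then ((L - m).choose (K - m - (x₁ + x₂)) : ℝ) else 0) *
            ((M₁ : ℝ) * M₂ + ((((M₁ + M₂ + L : ℕ)) : ℝ) - 1) * ((2 * (x₁ : ℝ) - M₁) * (2 * (x₂ : ℝ) - M₂))) =
          ((((M₁ + M₂ + L : ℕ)) : ℝ) - 1) * ∑ x₁ ∈ range (M₁ + 1), ∑ x₂ ∈ range (M₂ + 1),
          (M₁.choose x₁ : ℝ) * w₁ x₁ * ((M₂.choose x₂ : ℝ) * w₂ x₂) *
            (if x₁ + x₂ ≤ K - m then ((L - m).choose (K - m - (x₁ + x₂)) : ℝ) else 0) *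
            (κ + (2 * (x₁ : ℝ) - M₁) * (2 * (x₂ : ℝ) - M₂)) := by
        rw [mul_sum]
        refine sum_congr rfl fun x₁ _ => ?_
        rw [mul_sum]
        refine sum_congr rfl fun x₂ _ => ?_
        have hMM : (M₁ : ℝ) * M₂ = ((((M₁ + M₂ + L : ℕ)) : ℝ) - 1) * κ := by
          rw [hκ]; field_simp
        rw [hMM]; ring
      rw [e]
      exact mul_nonneg hNpos.le hU
    · -- N ≤ 1 with N = 2K even: N = 0, everything is empty and the only term vanishes
      have h1 : M₁ = 0 := by omega
      have h2 : M₂ = 0 := by omega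
      subst h1
      subst h2
      refine sum_nonneg fun x₁ hx₁ => sum_nonneg fun x₂ hx₂ => ?_
      have hx₁ : x₁ = 0 := by have := mem_range.mp hx₁; omega
      have hx₂ : x₂ = 0 := by have := mem_range.mp hx₂; omega
      subst hx₁
      subst hx₂
      have e : ((((0 : ℕ)) : ℝ) * (((0 : ℕ)) : ℝ) + ((((0 + 0 + L : ℕ)) : ℝ) - 1) *
          ((2 * (((0 : ℕ)) : ℝ) - (((0 : ℕ)) : ℝ)) * (2 * (((0 : ℕ)) : ℝ) - (((0 : ℕ)) : ℝ)))) = 0 := by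
        simp
      rw [e, mul_zero]


/-- **Block form of CORE(t) for every `ρ > 0`.**  As `core_rho`; for `ρ < 1` the sum equals `ρ^L` times the
same sum at `1/ρ ≥ 1`, by the reflection `x_b ↦ M_b - x_b` (buffer heads `z ↦ L - z`). -/
theorem core_rho_pos (M₁ M₂ L K : ℕ) (hN : 2 * K = M₁ + M₂ + L) (ρ : ℝ) (hρ : 0 < ρ)
    (w₁ w₂ : ℕ → ℝ) (hw₁nn : ∀ x, 0 ≤ w₁ x)
    (hw₁sym : ∀ x, x ≤ M₁ → w₁ x = w₁ (M₁ - x)) (hw₁uni : ∀ x, 2 * x + 2 ≤ M₁ → w₁ x ≤ w₁ (x + 1))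
    (hw₂nn : ∀ x, 0 ≤ w₂ x)
    (hw₂sym : ∀ x, x ≤ M₂ → w₂ x = w₂ (M₂ - x)) (hw₂uni : ∀ x, 2 * x + 2 ≤ M₂ → w₂ x ≤ w₂ (x + 1)) :
    0 ≤ ∑ x₁ ∈ range (M₁ + 1), ∑ x₂ ∈ range (M₂ + 1),
        (M₁.choose x₁ : ℝ) * w₁ x₁ * ((M₂.choose x₂ : ℝ) * w₂ x₂) *
          (if x₁ + x₂ ≤ K then (L.choose (K - (x₁ + x₂)) : ℝ) * ρ ^ (K - (x₁ + x₂)) else 0) *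
          ((M₁ : ℝ) * M₂ + ((((M₁ + M₂ + L : ℕ)) : ℝ) - 1) * ((2 * (x₁ : ℝ) - M₁) * (2 * (x₂ : ℝ) - M₂))) := by
  rcases le_or_gt 1 ρ with hρ1 | hρ1
  · exact core_rho M₁ M₂ L K hN ρ hρ1 w₁ w₂ hw₁nn hw₁sym hw₁uni hw₂nn hw₂sym hw₂uni
  · -- ρ < 1: reflect and use 1/ρ ≥ 1
    have hσ : 1 ≤ ρ⁻¹ := (one_le_inv₀ hρ).mpr hρ1.le
    have hpos := core_rho M₁ M₂ L K hN ρ⁻¹ hσ w₁ w₂ hw₁nn hw₁sym hw₁uni hw₂nn hw₂sym hw₂uni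
    rw [← CoreMaster.sum_reflect₂ M₁ M₂] at hpos
    have hρne : ρ ≠ 0 := hρ.ne'
    -- termwise: ρ^L · (reflected term at 1/ρ) = term at ρ
    have key : ∀ x₁ ∈ range (M₁ + 1), ∀ x₂ ∈ range (M₂ + 1),
        (M₁.choose x₁ : ℝ) * w₁ x₁ * ((M₂.choose x₂ : ℝ) * w₂ x₂) *
          (if x₁ + x₂ ≤ K then (L.choose (K - (x₁ + x₂)) : ℝ) * ρ ^ (K - (x₁ + x₂)) else 0) *
          ((M₁ : ℝ) * M₂ + ((((M₁ + M₂ + L : ℕ)) : ℝ) - 1) * ((2 * (x₁ : ℝ) - M₁) * (2 * (x₂ : ℝ) - M₂))) =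
        ρ ^ L * ((M₁.choose (M₁ - x₁) : ℝ) * w₁ (M₁ - x₁) * ((M₂.choose (M₂ - x₂) : ℝ) * w₂ (M₂ - x₂)) *
          (if M₁ - x₁ + (M₂ - x₂) ≤ K then
            (L.choose (K - (M₁ - x₁ + (M₂ - x₂))) : ℝ) * ρ⁻¹ ^ (K - (M₁ - x₁ + (M₂ - x₂))) else 0) *
          ((M₁ : ℝ) * M₂ + ((((M₁ + M₂ + L : ℕ)) : ℝ) - 1) *
            ((2 * (((M₁ - x₁ : ℕ)) : ℝ) - M₁) * (2 * (((M₂ - x₂ : ℕ)) : ℝ) - M₂)))) := by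
      intro x₁ hx₁ x₂ hx₂
      have hx₁M : x₁ ≤ M₁ := by have := mem_range.mp hx₁; omega
      have hx₂M : x₂ ≤ M₂ := by have := mem_range.mp hx₂; omega
      rw [Nat.choose_symm hx₁M, Nat.choose_symm hx₂M, ← hw₁sym x₁ hx₁M, ← hw₂sym x₂ hx₂M]
      have hd : ((2 * (((M₁ - x₁ : ℕ)) : ℝ) - M₁) * (2 * (((M₂ - x₂ : ℕ)) : ℝ) - M₂)) =
          ((2 * (x₁ : ℝ) - M₁) * (2 * (x₂ : ℝ) - M₂)) := by
        push_cast [Nat.cast_sub hx₁M, Nat.cast_sub hx₂M]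
        ring
      rw [hd]
      -- the buffer factor
      by_cases hK : x₁ + x₂ ≤ K
      · rw [if_pos hK]
        rcases le_or_gt (K - (x₁ + x₂)) L with hz | hz
        · -- genuine term: z ≤ L, reflected guard holds and K - (M₁-x₁+M₂-x₂) = L - z
          rw [if_pos (show M₁ - x₁ + (M₂ - x₂) ≤ K by omega)]
          have e : K - (M₁ - x₁ + (M₂ - x₂)) = L - (K - (x₁ + x₂)) := by omega
          rw [e, Nat.choose_symm hz, inv_pow, ← div_eq_mul_inv]
          have hpow : ρ ^ L / ρ ^ (L - (K - (x₁ + x₂))) = ρ ^ (K - (x₁ + x₂)) := by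
            rw [div_eq_iff (pow_ne_zero _ hρne), ← pow_add]
            congr 1
            omega
          calc (M₁.choose x₁ : ℝ) * w₁ x₁ * ((M₂.choose x₂ : ℝ) * w₂ x₂) *
                ((L.choose (K - (x₁ + x₂)) : ℝ) * ρ ^ (K - (x₁ + x₂))) *
                ((M₁ : ℝ) * M₂ + ((((M₁ + M₂ + L : ℕ)) : ℝ) - 1) * ((2 * (x₁ : ℝ) - M₁) * (2 * (x₂ : ℝ) - M₂)))
              = (M₁.choose x₁ : ℝ) * w₁ x₁ * ((M₂.choose x₂ : ℝ) * w₂ x₂) *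
                ((L.choose (K - (x₁ + x₂)) : ℝ) * (ρ ^ L / ρ ^ (L - (K - (x₁ + x₂))))) *
                ((M₁ : ℝ) * M₂ + ((((M₁ + M₂ + L : ℕ)) : ℝ) - 1) *
                  ((2 * (x₁ : ℝ) - M₁) * (2 * (x₂ : ℝ) - M₂))) := by rw [hpow]
            _ = _ := by ring
        · -- z > L: both sides vanish
          rw [Nat.choose_eq_zero_of_lt hz]
          by_cases hg : M₁ - x₁ + (M₂ - x₂) ≤ K
          · rw [if_pos hg, Nat.choose_eq_zero_of_lt (show L < K - (M₁ - x₁ + (M₂ - x₂)) by omega)]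
            simp
          · rw [if_neg hg]
            simp
      · rw [if_neg hK]
        by_cases hg : M₁ - x₁ + (M₂ - x₂) ≤ K
        · rw [if_pos hg, Nat.choose_eq_zero_of_lt (show L < K - (M₁ - x₁ + (M₂ - x₂)) by omega)]
          simp
        · rw [if_neg hg]
          simp
    rw [sum_congr rfl fun x₁ hx₁ => sum_congr rfl fun x₂ hx₂ => key x₁ hx₁ x₂ hx₂]
    simp_rw [← mul_sum]
    exact mul_nonneg (pow_nonneg hρ.le L) hpos

end CoreRho

end Summit.CriticalPhenomena.PercolationContinuityZ3.Theorems
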